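import Summits.QuantumFields.YangMills.Theorems.FluctuationComparisonRegPrIntLS2BetaCurlBudgetRegRep
import Summits.QuantumFields.YangMills.Theorems.FluctuationComparisonRegPrIntLS2BetaRelativeSizeProfileChartTower
import HarnessLib

/-!
# S2β · (SCT″-c)₁ — «THE c₁ LETTER OVER (BKG) + (REG)@rep LETTERS»: ✓p841381 `c1Budget_regRep`'s SIZE SIDE `(Mb) (hMb0 hMb hMb16) (m) (hMbsq hMbm)` DISCHARGED
# by px12 g27's ✓p841351 `sizeProfile_letters` (px20 g25's C-M ✓p840608 bootstrap at the chart tower: `‖X l b‖ ≤ Λ̄·(cX + Cr∕(L−1))·L^l·η`, `η = (L⁻¹)^{K−J}`), fed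
# with the (BKG) loop class `α l := if l < K−J then ((d+2)L)²∕4·θ_l else 0` + its all-`l` guards + one-power profile (`Cα = ((d+2)L)²∕4·(C_B+1)α`, `η² = (L^{2(K−J)})⁻¹`
# conversion), the already-displayed one-step second-order remainder letters `r hr0 hr Cr hrp` (same hypotheses feed the oscillation knot), ONE new (REG)@rep letter
# `hX0 : ‖X 0 b‖ ≤ cX·η` (the fine relative field's size — Thm 2 (1.36)₁ at the representative: `cX ≍ B₁s`), and ONE window `ha16 : 16·Λ̄(cX + Cr∕(L−1)) ≤ a₀`:
# `Mb l := Λ̄(cX + Cr∕(L−1))·L^l·η`, `m := Λ̄(cX + Cr∕(L−1))` EXPLICIT.  The c₁ letter `c1Budget_bkgRegRep` now displays ONLY: (T) `Mg`∕`Mbar` windows (✓p836413 station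
# prefix) · (BKG) `hBKG` + smallnesses `h24 hSU hρα hρδ hwinK ha16` · (REG)@rep letters `r` (`hr0 hr Cr hCr hrp`), `c₀` (`hc₀nn hc₀ Cc hCc hcc`), `mT` (`hmT hMT`), `cX`
# (`hcX hX0`) · `c hc0 hc4 hζc` (w5's ✓p841305 (γ) at the smooth-moved triple) · radii `ρr hρ0 hρr`, `a₀ ha0 ha` · texts `Cst REL`, `S′`.

Cell `ym3-torus` (YM ladder rung R3 = continuum `SU(2)` Yang–Mills on the three-torus at fixed lattice data — a RUNG: NOT d = 4, NOT infinite volume, NOT a mass gap,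
NOT Clay).  Width seat `ym-ust-20520-w4` (gen 29); crux `stmt-QuantumFields-20520`, LINE g18-1 S2β; piece (g4) (announced 05:06:52Z «NEXT (g4) when ⧗(C-M↓) lands»;
px20 g25 05:01:56Z «I take the fold as a separate file» → px12 g27 «MINE» 05:02:25Z → ✓p841351 05:16Z).  `--kind proof --supports stmt-QuantumFields-20520 --as helper`,
count-neutral, DEFINITION-FREE (0 `def`, 0 `instance`, 0 `notation`, 0 `sorry`, default heartbeats).

WHAT IS PROVED (sorry-free; composition BY NAME + elementary signs).  ★★`sizeSide_of_bkg (U₀ X) (C_B α) (hCB) (hα) (hBKG) (h24) (hSU) (r) (hr0 hr) (Cr hCr) (hrp) (cX hcX)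
(hX0) (ha16)` : the 5-tuple ⟨`0 ≤ Mb i`, `‖X i b‖ ≤ Mb i` (`Submodule.norm_coe`), `16·Mb i ≤ a₀`, `Mb i² ≤ m²·(L^{2i}∕L^{2(K−J)})`, `Mb i ≤ m`⟩ for `i < K−J`, stated in
the β-reduced shape ✓p841381's binders take; ★★★`c1Budget_bkgRegRep` = ✓p841381 with the size side REPLACED by `(cX hcX hX0) (ha16)` and `m` substituted in `A` —
`obtain ⟨…⟩ := sizeSide_of_bkg …; exact c1Budget_regRep …`.

DOMAIN LINE (plan (3) v4; architect px17 g23 05:01:11Z∕05:07:31Z «after (g3)∕(g4) the c₁ column's displayed list reads ONLY: BKG class + windows, Thm 2 letters (r, c₀,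
cX∕mT), hζc, (T)»).  [Balaban1985Averaging] (19)–(20) p.21, Prop. 3 (121)–(125) p.36, Prop. 4 (128)–(135) pp.37–38; [Balaban1985RegularSpaces] Thm 2 (1.36) p.82;
[Balaban1987RG1] (0.11), (0.18) pp.253–255.

HONEST SCOPE.  Composition of landed letters plus elementary signs; nothing of Bałaban's renormalisation-group analysis is asserted or proved; every displayed letter∕window
is a HYPOTHESIS or others'; GAP♯∘ (`stub_uniformFibreGapOrbit`, registry 3732b7df UNTOUCHED, 0∕5), S2β, the five registered stubs, crux 20520, 19936, 19200 and
`YM3TorusSU2` are NOT proved; no registered stub is closed; rung R3 — NOT d = 4, NOT infinite volume, NOT a mass gap, NOT Clay; the Yang–Mills mass gap is NOT proved.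
-/

set_option autoImplicit false

noncomputable section

open scoped Matrix.Norms.L2Operator
open Finset

namespace Summit.QuantumFields.YangMills.Theorems.FluctuationComparisonRegPrIntLS2BetaCurlBudgetBkgRegRep

open Literature.MathematicalPhysics.QuantumFieldTheory.Balaban1983to89
open Literature.MathematicalPhysics.QuantumFieldTheory.Balaban1983to89.T4Continuum
open Literature.MathematicalPhysics.QuantumFieldTheory.Balaban1983to89.T3ContinuumYM3Torus
open Literature.MathematicalPhysics.QuantumFieldTheory.Balaban1983to89.T3LevelShift
open Literature.MathematicalPhysics.QuantumFieldTheory.Balaban1983to89.T3TiltDescent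
open Literature.MathematicalPhysics.QuantumFieldTheory.Balaban1983to89.T3UnitLawDensityEML (ℰp)
open Literature.MathematicalPhysics.QuantumFieldTheory.Balaban1983to89.T4HaarSU2ExpChart (expPoint)
open Literature.MathematicalPhysics.QuantumFieldTheory.Balaban1983to89.T4ExpWindowSmallField (logVec)
open Literature.MathematicalPhysics.QuantumFieldTheory.Balaban1983to89.HaarExponentialChart
open Literature.MathematicalPhysics.QuantumFieldTheory.Balaban1983to89.HaarExponentialChart.IsChartRep
open Literature.MathematicalPhysics.QuantumFieldTheory.Balaban1983to89.BlockAveraging (Idx blockAvg avgFun loopHol)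
open Literature.MathematicalPhysics.QuantumFieldTheory.Balaban1983to89.ExpMeanLog (expMeanLogSU deltaSU)
open Literature.MathematicalPhysics.QuantumFieldTheory.Balaban1983to89.BlockAveragingEMLLinearisedBackground (covWalkSum)
open Literature.MathematicalPhysics.QuantumFieldTheory.Balaban1983to89.B10Eq47AxialChi (shiftN)
open Literature.MathematicalPhysics.QuantumFieldTheory.Balaban1983to89.B14.Eq22Determines (blockIter)
open Literature.MathematicalPhysics.QuantumFieldTheory.Balaban1983to89.B10Eq27TorusAxialLog (rel)
open Literature.MathematicalPhysics.QuantumFieldTheory.Balaban1983to89.B10Eq18SigmaSU2 (su2Coord)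
open Literature.MathematicalPhysics.QuantumFieldTheory.Balaban1983to89.B10Eq18SigmaSU2Haar (rev)
open Literature.MathematicalPhysics.QuantumLattice (su2Quat)
open Summit.QuantumFields.YangMills.Theorems.FluctuationComparisonRegPrIntLS2BetaChartReadDescentOntoExpPoint (su2Coord_rev_mem_lie)
open Summit.QuantumFields.YangMills.Theorems.FluctuationComparisonRegPrIntLS2BetaCurlBudgetRegRep (c1Budget_regRep)
open Summit.QuantumFields.YangMills.Theorems.FluctuationComparisonRegPrIntLS2BetaRelativeSizeProfileChartTower (sizeProfile_letters)
open Literature.MathematicalPhysics.QuantumFieldTheory.Balaban1983to89.B10Eq47AxialChi (rowProd)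
open Summit.QuantumFields.YangMills.Theorems.FluctuationComparisonRegPrIntLS2BetaChartReadGaugeCovariance (conj_mem_lie)
open Summit.QuantumFields.YangMills.Theorems.FluctuationComparisonRegPrIntLS2BetaSourceClassesOfBkg (plaqSmall_iter_of_bkg dist1_loopHol_iter_le_of_bkg bkgClass_nonneg bkgClass_lt_two_mul bkgClass_le_base)
open Literature.MathematicalPhysics.QuantumFieldTheory.Balaban1983to89.ExpMeanLog (deltaSU_pos)

variable (F : T3Family)

/-- ★★ **THE SIZE SIDE FROM (BKG) + THE FINE SIZE LETTER** — px12 g27's ✓p841351 `sizeProfile_letters` at the station with the (BKG) loop class, its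
guards and profile, the remainder letters `r`, the fine size letter `hX0` and the window `ha16`; returns ✓p841381's five size binders at
`Mb l := Λ̄(cX + Cr∕(L−1))·L^l·(L⁻¹)^(K−J)`, `m := Λ̄(cX + Cr∕(L−1))`. [cite: Balaban1985Averaging, Prop. 4 (130) p.37; Balaban1985RegularSpaces, Thm 2 (1.36) p.82] -/
theorem sizeSide_of_bkg {J K : ℕ}
    (U₀ : GaugeField (F.P K) 0 (Matrix.specialUnitaryGroup (Fin 2) ℂ))
    (X : (i : ℕ) → PBond (F.P K) i → (specialUnitaryLogChart (Fin 2)).lie)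
    (C_B α : ℝ) (hCB : 0 ≤ C_B) (hα : 0 < α)
    (hBKG : ∀ t, t ≤ K - J → ∀ p : Plaq (F.P K) t,
      dist1 (GaugeField.plaqHol (Averaging.iter (fun k => BlockAveraging.blockAvg (P := F.P K) (j := k) ℰp) t U₀) p) ≤
        C_B * α * (F.L : ℝ) ^ (2 * t) * ((F.L : ℝ)⁻¹) ^ (2 * (K - J)))
    (h24 : (((((F.P K).d + 2) * (F.P K).L : ℕ) : ℝ) ^ 2 / 4) * ((C_B + 1) * α) ≤ 1 / 24)
    (hSU : (((((F.P K).d + 2) * (F.P K).L : ℕ) : ℝ) ^ 2 / 4) * ((C_B + 1) * α) < deltaSU (Fin 2))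
    {a₀ : ℝ} (r : ℕ → ℝ)
    (hr0 : ∀ l, 0 ≤ r l)
    (hr : ∀ i, i < K - J → ∀ c' : PBond (F.P K) (i + 1),
      ‖((X (i + 1) c' : (specialUnitaryLogChart (Fin 2)).lie) : Matrix (Fin 2) (Fin 2) ℂ) - (((fderiv ℝ (fun (B : PBond (F.P K) i → (specialUnitaryLogChart (Fin 2)).lie) (c' : PBond (F.P K) (i + 1)) => (isChartRep_specialUnitaryGroup (n := Fin 2)).logChart (avgFun (expMeanLogSU (n := Fin 2)) (fun c => (isChartRep_specialUnitaryGroup (n := Fin 2)).expChart (B c) * (Averaging.iter (fun i => blockAvg (P := F.P K) (j := i) (expMeanLogSU (n := Fin 2))) i U₀) c) c' * (avgFun (expMeanLogSU (n := Fin 2)) ((Averaging.iter (fun i => blockAvg (P := F.P K) (j := i) (expMeanLogSU (n := Fin 2))) i U₀)) c')⁻¹)) 0) (X i) c' : (specialUnitaryLogChart (Fin 2)).lie) : Matrix (Fin 2) (Fin 2) ℂ)‖ ≤ r (i + 1))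
    (Cr : ℝ) (hCr : 0 ≤ Cr)
    (hrp : ∀ i, i < K - J → r (i + 1) ≤ Cr * ((F.P K).L : ℝ) ^ (2 * i) * ((F.L : ℝ) ^ (2 * (K - J)))⁻¹)
    (cX : ℝ) (hcX : 0 ≤ cX)
    (hX0 : ∀ b : PBond (F.P K) 0, ‖(((X 0) b : (specialUnitaryLogChart (Fin 2)).lie) : Matrix (Fin 2) (Fin 2) ℂ)‖ ≤ cX * ((((F.P K).L : ℝ))⁻¹ ^ (K - J)))
    (ha16 : 16 * (((1 + 4 * (((F.P K).d + 2 : ℕ) : ℝ)) * Real.exp ((((F.P K).d + 2 : ℕ) : ℝ) * (422 + 1616 * (((F.P K).d + 2 : ℕ) : ℝ)) * (((((((F.P K).d + 2) * (F.P K).L : ℕ) : ℝ) ^ 2 / 4) * ((C_B + 1) * α)) / (((F.P K).L : ℝ) ^ 2 - 1)))) * (cX + Cr / (((F.P K).L : ℝ) - 1))) ≤ a₀) :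
    (∀ i, i < K - J → 0 ≤ ((1 + 4 * (((F.P K).d + 2 : ℕ) : ℝ)) * Real.exp ((((F.P K).d + 2 : ℕ) : ℝ) * (422 + 1616 * (((F.P K).d + 2 : ℕ) : ℝ)) * (((((((F.P K).d + 2) * (F.P K).L : ℕ) : ℝ) ^ 2 / 4) * ((C_B + 1) * α)) / (((F.P K).L : ℝ) ^ 2 - 1)))) * (cX + Cr / (((F.P K).L : ℝ) - 1)) * ((F.P K).L : ℝ) ^ i * ((((F.P K).L : ℝ))⁻¹ ^ (K - J))) ∧
    (∀ i, i < K - J → ∀ b : PBond (F.P K) i, ‖X i b‖ ≤ ((1 + 4 * (((F.P K).d + 2 : ℕ) : ℝ)) * Real.exp ((((F.P K).d + 2 : ℕ) : ℝ) * (422 + 1616 * (((F.P K).d + 2 : ℕ) : ℝ)) * (((((((F.P K).d + 2) * (F.P K).L : ℕ) : ℝ) ^ 2 / 4) * ((C_B + 1) * α)) / (((F.P K).L : ℝ) ^ 2 - 1)))) * (cX + Cr / (((F.P K).L : ℝ) - 1)) * ((F.P K).L : ℝ) ^ i * ((((F.P K).L : ℝ))⁻¹ ^ (K - J))) ∧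
    (∀ i, i < K - J → 16 * (((1 + 4 * (((F.P K).d + 2 : ℕ) : ℝ)) * Real.exp ((((F.P K).d + 2 : ℕ) : ℝ) * (422 + 1616 * (((F.P K).d + 2 : ℕ) : ℝ)) * (((((((F.P K).d + 2) * (F.P K).L : ℕ) : ℝ) ^ 2 / 4) * ((C_B + 1) * α)) / (((F.P K).L : ℝ) ^ 2 - 1)))) * (cX + Cr / (((F.P K).L : ℝ) - 1)) * ((F.P K).L : ℝ) ^ i * ((((F.P K).L : ℝ))⁻¹ ^ (K - J))) ≤ a₀) ∧
    (∀ i, i < K - J → (((1 + 4 * (((F.P K).d + 2 : ℕ) : ℝ)) * Real.exp ((((F.P K).d + 2 : ℕ) : ℝ) * (422 + 1616 * (((F.P K).d + 2 : ℕ) : ℝ)) * (((((((F.P K).d + 2) * (F.P K).L : ℕ) : ℝ) ^ 2 / 4) * ((C_B + 1) * α)) / (((F.P K).L : ℝ) ^ 2 - 1)))) * (cX + Cr / (((F.P K).L : ℝ) - 1)) * ((F.P K).L : ℝ) ^ i * ((((F.P K).L : ℝ))⁻¹ ^ (K - J))) ^ 2 ≤ (((1 + 4 * (((F.P K).d + 2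 : ℕ) : ℝ)) * Real.exp ((((F.P K).d + 2 : ℕ) : ℝ) * (422 + 1616 * (((F.P K).d + 2 : ℕ) : ℝ)) * (((((((F.P K).d + 2) * (F.P K).L : ℕ) : ℝ) ^ 2 / 4) * ((C_B + 1) * α)) / (((F.P K).L : ℝ) ^ 2 - 1)))) * (cX + Cr / (((F.P K).L : ℝ) - 1))) ^ 2 * ((F.L : ℝ) ^ (2 * i) / (F.L : ℝ) ^ (2 * (K - J)))) ∧
    (∀ i, i < K - J → ((1 + 4 * (((F.P K).d + 2 : ℕ) : ℝ)) * Real.exp ((((F.P K).d + 2 : ℕ) : ℝ) * (422 + 1616 * (((F.P K).d + 2 : ℕ) : ℝ)) * (((((((F.P K).d + 2) * (F.P K).L : ℕ) : ℝ) ^ 2 / 4) * ((C_B + 1) * α)) / (((F.P K).L : ℝ) ^ 2 - 1)))) * (cX + Cr / (((F.P K).L : ℝ) - 1)) * ((F.P K).L : ℝ) ^ i * ((((F.P K).L : ℝ))⁻¹ ^ (K - J)) ≤ (((1 + 4 * (((F.P K).d + 2 : ℕ) : ℝ)) * Real.exp ((((F.P K).d + 2 : ℕ) : ℝ) * (422 +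 1616 * (((F.P K).d + 2 : ℕ) : ℝ)) * (((((((F.P K).d + 2) * (F.P K).L : ℕ) : ℝ) ^ 2 / 4) * ((C_B + 1) * α)) / (((F.P K).L : ℝ) ^ 2 - 1)))) * (cX + Cr / (((F.P K).L : ℝ) - 1))))
:= by
  have hL2 : (2 : ℝ) ≤ (F.L : ℝ) := by exact_mod_cast F.hL.2
  have hL1 : (1 : ℝ) ≤ (F.L : ℝ) := by linarith
  have hL0 : (0 : ℝ) ≤ (F.L : ℝ) := by linarith
  have hCB1 : (0 : ℝ) ≤ C_B + 1 := by linarith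
  have hpos : 0 < (C_B + 1) * α := by positivity
  have hKA0 : (0 : ℝ) ≤ (((((F.P K).d + 2) * (F.P K).L : ℕ) : ℝ) ^ 2 / 4) := by positivity
  have hδSU : 0 < deltaSU (Fin 2) := deltaSU_pos
  have hBKG' : ∀ t, t ≤ K - J → ∀ p : Plaq (F.P K) t,
      dist1 (GaugeField.plaqHol (Averaging.iter (fun k => BlockAveraging.blockAvg (P := F.P K) (j := k) ℰp) t U₀) p) ≤
        (C_B + 1) * α * (F.L : ℝ) ^ (2 * t) * ((F.L : ℝ)⁻¹) ^ (2 * (K - J)) := by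
    intro t ht p
    refine (hBKG t ht p).trans ?_
    have h0 : 0 ≤ α * (F.L : ℝ) ^ (2 * t) * ((F.L : ℝ)⁻¹) ^ (2 * (K - J)) :=
      mul_nonneg (mul_nonneg hα.le (pow_nonneg hL0 _)) (pow_nonneg (inv_nonneg.2 hL0) _)
    have h1 : C_B * α * (F.L : ℝ) ^ (2 * t) * ((F.L : ℝ)⁻¹) ^ (2 * (K - J)) =
        C_B * (α * (F.L : ℝ) ^ (2 * t) * ((F.L : ℝ)⁻¹) ^ (2 * (K - J))) := by ring
    have h2 : (C_B + 1) * α * (F.L : ℝ) ^ (2 * t) * ((F.L : ℝ)⁻¹) ^ (2 * (K - J)) =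
        (C_B + 1) * (α * (F.L : ℝ) ^ (2 * t) * ((F.L : ℝ)⁻¹) ^ (2 * (K - J))) := by ring
    rw [h1, h2]
    exact mul_le_mul_of_nonneg_right (by linarith) h0
  have hθ0 : ∀ l : ℕ, 0 ≤ ((C_B + 1) * α * (F.L : ℝ) ^ (2 * l) * ((F.L : ℝ)⁻¹) ^ (2 * (K - J))) := fun l => bkgClass_nonneg F (C_B + 1) α hCB1 hα.le l
  have hθle : ∀ l, l < K - J → ((C_B + 1) * α * (F.L : ℝ) ^ (2 * l) * ((F.L : ℝ)⁻¹) ^ (2 * (K - J))) ≤ (C_B + 1) * α := fun l hl => bkgClass_le_base F (C_B + 1) α hCB1 hα.le hL1 hl.le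
  -- the knot's loop class `α l := if l < K−J then kα·θ_l else 0` and its all-`l` guards
  have hα0' : ∀ l, 0 ≤ (fun l : ℕ => if l < K - J then (((((F.P K).d + 2) * (F.P K).L : ℕ) : ℝ) ^ 2 / 4) * ((C_B + 1) * α * (F.L : ℝ) ^ (2 * l) * ((F.L : ℝ)⁻¹) ^ (2 * (K - J))) else 0) l := by
    intro l; dsimp only; split_ifs
    · exact mul_nonneg hKA0 (hθ0 l)
    · exact le_rfl
  have hα24' : ∀ l, (fun l : ℕ => if l < K - J then (((((F.P K).d + 2) * (F.P K).L : ℕ) : ℝ) ^ 2 / 4) * ((C_B + 1) * α * (F.L : ℝ) ^ (2 * l) * ((F.L : ℝ)⁻¹) ^ (2 * (K - J))) else 0) l ≤ 1 / 24 := by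
    intro l; dsimp only; split_ifs with hl
    · have h := mul_le_mul_of_nonneg_left (hθle l hl) hKA0
      linarith
    · norm_num
  have hαδ' : ∀ l, (fun l : ℕ => if l < K - J then (((((F.P K).d + 2) * (F.P K).L : ℕ) : ℝ) ^ 2 / 4) * ((C_B + 1) * α * (F.L : ℝ) ^ (2 * l) * ((F.L : ℝ)⁻¹) ^ (2 * (K - J))) else 0) l < deltaSU (Fin 2) := by
    intro l; dsimp only; split_ifs with hl
    · have h := mul_le_mul_of_nonneg_left (hθle l hl) hKA0
      linarith
    · exact hδSU
  have hαU' : ∀ l, l < K - J → ∀ (c : PBond (F.P K) (l + 1)) (idx : Idx (F.P K)),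
      dist1 (loopHol (Averaging.iter (fun k => BlockAveraging.blockAvg (P := F.P K) (j := k) ℰp) l U₀) c idx) ≤ (fun l : ℕ => if l < K - J then (((((F.P K).d + 2) * (F.P K).L : ℕ) : ℝ) ^ 2 / 4) * ((C_B + 1) * α * (F.L : ℝ) ^ (2 * l) * ((F.L : ℝ)⁻¹) ^ (2 * (K - J))) else 0) l := by
    intro l hl c idx
    dsimp only; rw [if_pos hl]
    exact dist1_loopHol_iter_le_of_bkg F U₀ (C_B + 1) α hCB1 hα.le hBKG' l hl c idx
  have hL1' : (1 : ℝ) < ((F.P K).L : ℝ) := by show (1 : ℝ) < (F.L : ℝ); exact one_lt_two.trans_le hL2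
  have hPL0 : (0 : ℝ) ≤ ((F.P K).L : ℝ) := zero_le_one.trans hL1'.le
  have h2 : (0 : ℝ) ≤ ((F.P K).L : ℝ) - 1 := sub_nonneg.2 hL1'.le
  have hCα : (0 : ℝ) ≤ ((((((F.P K).d + 2) * (F.P K).L : ℕ) : ℝ) ^ 2 / 4) * ((C_B + 1) * α)) := by positivity
  have e2 : ((((F.P K).L : ℝ))⁻¹ ^ (K - J)) ^ 2 = ((F.L : ℝ) ^ (2 * (K - J)))⁻¹ := by
    rw [← pow_mul, inv_pow]
    show ((F.L : ℝ) ^ ((K - J) * 2))⁻¹ = ((F.L : ℝ) ^ (2 * (K - J)))⁻¹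
    rw [Nat.mul_comm]
  have hαp2 : ∀ j, j < K - J → (fun l : ℕ => if l < K - J then (((((F.P K).d + 2) * (F.P K).L : ℕ) : ℝ) ^ 2 / 4) * ((C_B + 1) * α * (F.L : ℝ) ^ (2 * l) * ((F.L : ℝ)⁻¹) ^ (2 * (K - J))) else 0) j ≤ ((((((F.P K).d + 2) * (F.P K).L : ℕ) : ℝ) ^ 2 / 4) * ((C_B + 1) * α)) * ((F.P K).L : ℝ) ^ (2 * j) * ((((F.P K).L : ℝ))⁻¹ ^ (K - J)) ^ 2 := by
    intro j hj
    rw [e2]; dsimp only; rw [if_pos hj]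
    show (((((F.P K).d + 2) * (F.P K).L : ℕ) : ℝ) ^ 2 / 4) * ((C_B + 1) * α * (F.L : ℝ) ^ (2 * j) * ((F.L : ℝ)⁻¹) ^ (2 * (K - J))) ≤ ((((((F.P K).d + 2) * (F.P K).L : ℕ) : ℝ) ^ 2 / 4) * ((C_B + 1) * α)) * (F.L : ℝ) ^ (2 * j) * ((F.L : ℝ) ^ (2 * (K - J)))⁻¹
    rw [inv_pow]; exact le_of_eq (by ring)
  have hrp2 : ∀ i, i < K - J → r (i + 1) ≤ Cr * ((F.P K).L : ℝ) ^ (2 * i) * ((((F.P K).L : ℝ))⁻¹ ^ (K - J)) ^ 2 := fun i hi => by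
    rw [e2]; exact hrp i hi
  obtain ⟨h1, h2', h3'⟩ := sizeProfile_letters F (K := K) (J := J) (by have := F.hm; omega) U₀ X hα0' hα24' hαδ' hαU'
    hCα hαp2 hcX hX0 hr0 hCr hr hrp2
  have hm0 : 0 ≤ (((1 + 4 * (((F.P K).d + 2 : ℕ) : ℝ)) * Real.exp ((((F.P K).d + 2 : ℕ) : ℝ) * (422 + 1616 * (((F.P K).d + 2 : ℕ) : ℝ)) * (((((((F.P K).d + 2) * (F.P K).L : ℕ) : ℝ) ^ 2 / 4) * ((C_B + 1) * α)) / (((F.P K).L : ℝ) ^ 2 - 1)))) * (cX + Cr / (((F.P K).L : ℝ) - 1))) := mul_nonneg (by positivity) (add_nonneg hcX (div_nonneg hCr h2))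
  refine ⟨?_, ?_, ?_, ?_, ?_⟩
  · intro i _
    exact mul_nonneg (mul_nonneg (mul_nonneg (by positivity) (add_nonneg hcX (div_nonneg hCr h2))) (pow_nonneg hPL0 _))
      (pow_nonneg (inv_nonneg.2 hPL0) _)
  · intro i hi b
    have h := h1 i hi.le b
    rwa [Submodule.norm_coe] at h
  · intro i hi
    exact (mul_le_mul_of_nonneg_left (h3' i hi.le) (by norm_num)).trans ha16
  · intro i hi
    exact (h2' i hi.le).le
  · intro i hi
    exact h3' i hi.le

/-- ★★★ **THE c₁ LETTER OVER (BKG) + (REG)@rep LETTERS** — ✓`c1Budget_regRep` ∘ ✓`sizeSide_of_bkg`; see the module header.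
[cite: Balaban1985Averaging, Prop. 3 (123), Prop. 4 (128)-(135) pp.37-38; Balaban1985RegularSpaces, Thm 2 (1.36) p.82; Balaban1987RG1, (0.11), (0.18) pp.253-255] -/
theorem c1Budget_bkgRegRep {J K : ℕ} (hJK : J ≤ K) (Cst : ℝ) (hCst : 0 ≤ Cst)
    (U₀ : GaugeField (F.P K) 0 (Matrix.specialUnitaryGroup (Fin 2) ℂ)) (ζ : PBond (F.P K) 0 → EuclideanSpace ℝ (Fin 3))
    (X : (i : ℕ) → PBond (F.P K) i → (specialUnitaryLogChart (Fin 2)).lie)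
    (hXdef : X = fun (i : ℕ) (b : PBond (F.P K) i) =>
      (⟨su2Coord (rev (logVec (su2Quat (Averaging.iter (fun k => BlockAveraging.blockAvg (P := F.P K) (j := k) ℰp) i (fun ℓ => expPoint (ζ ℓ) * U₀ ℓ : GaugeField (F.P K) 0 (Matrix.specialUnitaryGroup (Fin 2) ℂ)) b * (Averaging.iter (fun k => BlockAveraging.blockAvg (P := F.P K) (j := k) ℰp) i U₀ b)⁻¹)))), su2Coord_rev_mem_lie _⟩ : (specialUnitaryLogChart (Fin 2)).lie))
    (Mg : ℕ → ℝ) (hMg : ∀ t, t ≤ K - J → ∀ b : PBond (F.P K) t,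
      ‖logVec (su2Quat (Averaging.iter (fun k => BlockAveraging.blockAvg (P := F.P K) (j := k) ℰp) t (fun ℓ => expPoint (ζ ℓ) * U₀ ℓ : GaugeField (F.P K) 0 (Matrix.specialUnitaryGroup (Fin 2) ℂ)) b * (Averaging.iter (fun k => BlockAveraging.blockAvg (P := F.P K) (j := k) ℰp) t U₀ b)⁻¹))‖ ≤ Mg t)
    (hMg4 : ∀ t, t ≤ K - J → Mg t ≤ 1 / 4)
    (C_B α : ℝ) (hCB : 0 ≤ C_B) (hα : 0 < α)
    (hBKG : ∀ t, t ≤ K - J → ∀ p : Plaq (F.P K) t,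
      dist1 (GaugeField.plaqHol (Averaging.iter (fun k => BlockAveraging.blockAvg (P := F.P K) (j := k) ℰp) t U₀) p) ≤
        C_B * α * (F.L : ℝ) ^ (2 * t) * ((F.L : ℝ)⁻¹) ^ (2 * (K - J)))
    (h24 : ((((F.P K).d + 2) * (F.P K).L : ℕ) : ℝ) ^ 2 / 4 * ((C_B + 1) * α) ≤ 1 / 24)
    (hSU : ((((F.P K).d + 2) * (F.P K).L : ℕ) : ℝ) ^ 2 / 4 * ((C_B + 1) * α) < deltaSU (Fin 2))
    {ρr : ℝ} (hρ0 : 0 < ρr) (hρr : ρr ≤ innerRadius (specialUnitaryLogChart (Fin 2)))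
    {a₀ : ℝ} (ha0 : 0 < a₀) (ha : 100 * (((((F.P K).d + 2) * (F.P K).L : ℕ) : ℝ) * (Real.exp a₀ - 1)) ≤ ρr)
    (r c₀ : ℕ → ℝ)
    (hwinK : 100 * (((((F.P K).d + 2) * (F.P K).L : ℕ) : ℝ) * (2 * ((((F.P K).d - 1 : ℕ) : ℝ) * ((2 * (F.P K).L : ℕ) : ℝ)) * (2 * ((C_B + 1) * α)) + (2 * (2 * ((((((F.P K).d + 2) * (F.P K).L : ℕ) : ℝ) ^ 2 / 4) * ((C_B + 1) * α)) / (((F.P K).L : ℝ) ^ 2 - ((F.P K).L : ℝ))) + (2 * ((C_B + 1) * α))))) ≤ ρr)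
    (hc₀nn : ∀ k, 0 ≤ (F.L : ℝ) ^ k * c₀ k)
    (hc₀ : ∀ k, k < K - J → ∀ (μ : Fin (F.P K).d) (b : PBond (F.P K) 0), ‖(((fun b : PBond (F.P K) 0 => (⟨((rowProd U₀ b.src μ ((F.P K).L ^ k) : Matrix.specialUnitaryGroup (Fin 2) ℂ) : Matrix (Fin 2) (Fin 2) ℂ) * (((X 0) (b.translate (Site.scaleTo k ((0 : Site (F.P K) k).shift μ))) : (specialUnitaryLogChart (Fin 2)).lie) : Matrix (Fin 2) (Fin 2) ℂ) * star ((rowProd U₀ b.src μ ((F.P K).L ^ k) : Matrix.specialUnitaryGroup (Fin 2) ℂ) : Matrix (Fin 2) (Fin 2) ℂ), conj_mem_lie (rowProd U₀ b.src μ ((F.P K).L ^ k)) ((X 0) (b.translate (Site.scaleTo k ((0 : Site (F.P K) k).shift μ))))⟩ : (specialUnitaryLogChart (Fin 2)).lie)) b : (specialUnitaryLogChart (Fin 2)).lie) : Matrix (Fin 2) (Fin 2) ℂ) - (((X 0) b : (specialUnitaryLogChart (Fin 2)).lie) : Matrix (Fin 2) (Fin 2) ℂ)‖ ≤ (F.L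 : ℝ) ^ k * c₀ k)
    (hr0 : ∀ l, 0 ≤ r l)
    (hr : ∀ i, i < K - J → ∀ c' : PBond (F.P K) (i + 1),
      ‖((X (i + 1) c' : (specialUnitaryLogChart (Fin 2)).lie) : Matrix (Fin 2) (Fin 2) ℂ) - (((fderiv ℝ (fun (B : PBond (F.P K) i → (specialUnitaryLogChart (Fin 2)).lie) (c' : PBond (F.P K) (i + 1)) => (isChartRep_specialUnitaryGroup (n := Fin 2)).logChart (avgFun (expMeanLogSU (n := Fin 2)) (fun c => (isChartRep_specialUnitaryGroup (n := Fin 2)).expChart (B c) * (Averaging.iter (fun i => blockAvg (P := F.P K) (j := i) (expMeanLogSU (n := Fin 2))) i U₀) c) c' * (avgFun (expMeanLogSU (n := Fin 2)) ((Averaging.iter (fun i => blockAvg (P := F.P K) (j := i) (expMeanLogSU (n := Fin 2))) i U₀)) c')⁻¹)) 0) (X i) c' : (specialUnitaryLogChart (Fin 2)).lie) : Matrix (Fin 2) (Fin 2) ℂ)‖ ≤ r (i + 1))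
    (Cr Cc mT : ℝ) (hCr : 0 ≤ Cr) (hCc : 0 ≤ Cc) (hmT : 0 ≤ mT)
    (hrp : ∀ i, i < K - J → r (i + 1) ≤ Cr * ((F.P K).L : ℝ) ^ (2 * i) * ((F.L : ℝ) ^ (2 * (K - J)))⁻¹)
    (cX : ℝ) (hcX : 0 ≤ cX)
    (hX0 : ∀ b : PBond (F.P K) 0, ‖(((X 0) b : (specialUnitaryLogChart (Fin 2)).lie) : Matrix (Fin 2) (Fin 2) ℂ)‖ ≤ cX * ((((F.P K).L : ℝ))⁻¹ ^ (K - J)))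
    (ha16 : 16 * (((1 + 4 * (((F.P K).d + 2 : ℕ) : ℝ)) * Real.exp ((((F.P K).d + 2 : ℕ) : ℝ) * (422 + 1616 * (((F.P K).d + 2 : ℕ) : ℝ)) * (((((((F.P K).d + 2) * (F.P K).L : ℕ) : ℝ) ^ 2 / 4) * ((C_B + 1) * α)) / (((F.P K).L : ℝ) ^ 2 - 1)))) * (cX + Cr / (((F.P K).L : ℝ) - 1))) ≤ a₀)
    (hMT : ∀ k, k < K - J → ((1 + 4 * (((F.P K).d + 2 : ℕ) : ℝ)) * Real.exp ((((F.P K).d + 2 : ℕ) : ℝ) * (422 + 1616 * (((F.P K).d + 2 : ℕ) : ℝ)) * (((((((F.P K).d + 2) * (F.P K).L : ℕ) : ℝ) ^ 2 / 4) * ((C_B + 1) * α)) / (((F.P K).L : ℝ) ^ 2 - 1)))) * ((F.P K).L : ℝ) ^ k * ‖X 0‖ ≤ mT)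
    (hcc : ∀ k, k < K - J → ((1 + 4 * (((F.P K).d + 2 : ℕ) : ℝ)) * Real.exp ((((F.P K).d + 2 : ℕ) : ℝ) * (422 + 1616 * (((F.P K).d + 2 : ℕ) : ℝ)) * (((((((F.P K).d + 2) * (F.P K).L : ℕ) : ℝ) ^ 2 / 4) * ((C_B + 1) * α)) / (((F.P K).L : ℝ) ^ 2 - 1)))) * ((F.P K).L : ℝ) ^ k * ((F.L : ℝ) ^ k * c₀ k) ≤ Cc * (((F.P K).L : ℝ) ^ (2 * k) * ((F.L : ℝ) ^ (2 * (K - J)))⁻¹))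
    (hρα : 4 * ((((((F.P K).d + 2) * (F.P K).L : ℕ) : ℝ) ^ 2 / 4) * (2 * ((C_B + 1) * α))) ≤ ρr)
    (hρδ : 100 * (((((F.P K).d + 2) * (F.P K).L : ℕ) : ℝ) * ((((F.P K).d - 1 : ℕ) : ℝ) * ((3 * (F.P K).L : ℕ) : ℝ) * (2 * ((C_B + 1) * α)))) ≤ ρr)
    (c : ℝ) (hc0 : 0 ≤ c) (hc4 : 4 * c ≤ 1)
    (hζc : ∀ ℓ : PBond (F.P K) 0, ‖ζ ℓ‖ ≤ c * ((F.L : ℝ)⁻¹) ^ (K - J))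
    (Mbar : ℝ) (hM0 : 0 ≤ Mbar) (hM1 : 4 * Mbar ≤ 1)
    (hM : ∀ s, s < K - J → ∀ b : PBond (F.P K) s, ‖logVec (su2Quat (Averaging.iter (fun k => BlockAveraging.blockAvg (P := F.P K) (j := k) ℰp) s (fun ℓ => expPoint (ζ ℓ) * U₀ ℓ : GaugeField (F.P K) 0 (Matrix.specialUnitaryGroup (Fin 2) ℂ)) b * (Averaging.iter (fun k => BlockAveraging.blockAvg (P := F.P K) (j := k) ℰp) s U₀ b)⁻¹))‖ ≤ Mbar) :
    ∑ t ∈ Finset.range (K - J), (F.L : ℝ) ^ t * (fun t => Cst * ∑ B : PBond (F.P J) 0,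
      ‖(fun p : Plaq (F.P K) (K - J - 1 - t) =>
        if ∃ z₀ : Site (F.P K) 0, (blockIter (K - J) z₀ = (bondShift (F.sitesPerDir_eq (m := F.m) (K := J) (j := 0) (m' := F.m) (K' := K) (j' := K - J) (by omega)) B).src ∨
            blockIter (K - J) z₀ = (bondShift (F.sitesPerDir_eq (m := F.m) (K := J) (j := 0) (m' := F.m) (K' := K) (j' := K - J) (by omega)) B).tgt) ∧
            ∀ κ, (rel (blockIter (K - J - 1 - t) z₀) p.src κ).natAbs ≤ (2 * F.L + 1)
        then dist1 ((GaugeField.plaqHol (Averaging.iter (fun k => BlockAveraging.blockAvg (P := F.P K) (j := k) ℰp) (K - J - 1 - t) U₀) p)⁻¹ *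
          GaugeField.plaqHol (Averaging.iter (fun k => BlockAveraging.blockAvg (P := F.P K) (j := k) ℰp) (K - J - 1 - t)
            (fun ℓ => expPoint (ζ ℓ) * U₀ ℓ : GaugeField (F.P K) 0 (Matrix.specialUnitaryGroup (Fin 2) ℂ))) p)
        else 0)‖ ^ 2) t ≤
      2 * ((2 * Cst * (((5 ^ (F.P K).d : ℕ) : ℝ) ^ 2 * (((2 * ((2 * F.L + 1) + 2) + 1) ^ (F.P K).d * 6 : ℕ) : ℝ) *
              (2 * ((((F.P K).L ^ (F.P K).d : ℕ) : ℝ) - 1) / ((((F.P K).L ^ (F.P K).d : ℕ) : ℝ) - 3)))) * (4 * (F.L : ℝ)⁻¹ * ((F.L : ℝ) ^ (K - J) * ∑ p : Plaq (F.P K) 0,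
                  (1 - reTr ((GaugeField.plaqHol U₀ p)⁻¹ * GaugeField.plaqHol (fun ℓ => expPoint (ζ ℓ) * U₀ ℓ : GaugeField (F.P K) 0 (Matrix.specialUnitaryGroup (Fin 2) ℂ)) p))) + 7 *
      (12 * ((F.P K).d : ℝ) ^ 2 * (2 * ((F.P K).L : ℝ) ^ 2 * (3 * (F.P K).L + 2) + 2 * ((F.P K).L : ℝ) ^ 2 + (48 * (F.P K).L + 24 * ((((F.P K).d + 2) * (F.P K).L : ℕ) : ℝ) + 1616 * ((((F.P K).d + 2) * (F.P K).L : ℕ) : ℝ)) * (((((F.P K).d + 2) * (F.P K).L : ℕ) : ℝ) ^ 2 / 4) +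
        2 * ((((F.P K).d + 2) * (F.P K).L : ℕ) : ℝ) * ((F.L : ℝ) ^ 2)) ^ 2 * (2 * ((C_B + 1) * α)) ^ 2 *
        (∑ t ∈ Finset.range (K - J), (if ht : t < K - J then
          (F.L : ℝ) ^ t * ∑ B : PBond (F.P J) 0,
            ‖(fun ℓ' : PBond (F.P (J + (t + 1))) 0 =>
              if ∃ z : Site (F.P (J + (t + 1))) 0,
                (B14.Eq22Determines.blockIter (t + 1) z = (bondShift (F.sitesPerDir_eq (m := F.m) (K := J) (j := 0) (m' := F.m) (K' := J + (t + 1)) (j' := t + 1) (by omega)) B).src ∨ B14.Eq22Determines.blockIter (t + 1) z = (bondShift (F.sitesPerDir_eq (m := F.m) (K := J) (j := 0) (m' := F.m) (K' := J + (t + 1)) (j' := t + 1) (by omega)) B).tgt) ∧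
                ∀ ν, (B10Eq27TorusAxialLog.rel z ℓ'.src ν).natAbs ≤ 2
              then logVec (su2Quat (descendTo F ℰp (J + (t + 1)) K (by omega) (fun ℓ => expPoint (ζ ℓ) * U₀ ℓ : GaugeField (F.P K) 0 (Matrix.specialUnitaryGroup (Fin 2) ℂ)) ℓ' * (descendTo F ℰp (J + (t + 1)) K (by omega) U₀ ℓ')⁻¹)) else 0)‖ ^ 2
        else 0)) / (F.L : ℝ) +
      (192 * ((F.P K).d : ℝ) ^ 2 *
        (16 * (54 * (((((F.P K).d + 2) * (F.P K).L : ℕ) : ℝ) * (Real.exp a₀ - 1))) * (2 * ((((F.P K).d : ℕ) : ℝ) * ((3 * (F.P K).L : ℕ) : ℝ)) * (2 * (2 * ((((((F.P K).d + 2) * (F.P K).L : ℕ) : ℝ) ^ 2 / 4) * ((C_B + 1) * α)) / (((F.P K).L : ℝ) ^ 2 - ((F.P K).L : ℝ))) * mT + mT * (((1 + 4 * (((F.P K).d + 2 : ℕ) : ℝ)) * Real.exp ((((F.P K).d + 2 : ℕ) : ℝ) * (422 + 1616 * (((F.P K).d + 2 : ℕ) : ℝ)) * (((((((F.P K).d +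 2) * (F.P K).L : ℕ) : ℝ) ^ 2 / 4) * ((C_B + 1) * α)) / (((F.P K).L : ℝ) ^ 2 - 1)))) / ((F.P K).L : ℝ)) * ((2 * 67 * ((((F.P K).d + 2) * (F.P K).L : ℕ) : ℝ) / a₀) * (2 * ((((F.P K).d - 1 : ℕ) : ℝ) * ((2 * (F.P K).L : ℕ) : ℝ)) * (2 * ((C_B + 1) * α)) / (((F.P K).L : ℝ) ^ 2 - 1) + (2 * (2 * ((((((F.P K).d + 2) * (F.P K).L : ℕ) : ℝ) ^ 2 / 4) * ((C_B + 1) * α)) / (((F.P K).L : ℝ) ^ 2 - ((F.P K).L : ℝ))) + (2 * ((C_B + 1) * α))) / (((F.P K).L : ℝ) - 1))) + Cc + 2 * (((1 + 4 * (((F.P K).d + 2 : ℕ) : ℝ)) * Real.exp ((((F.P K).d + 2 : ℕ) : ℝ) * (422 + 1616 * (((F.P K).d + 2 : ℕ) : ℝ)) * (((((((F.P K).d + 2) * (F.P K).L : ℕ) : ℝ) ^ 2 / 4) * ((C_B + 1) * α)) / (((F.P K).L : ℝ) ^ 2 - 1)))) * Cr / (((F.P K).L : ℝ) ^ 2 -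 ((F.P K).L : ℝ))))) / (15 * a₀ / 16) ^ 2 + 32 * (54 * (((((F.P K).d + 2) * (F.P K).L : ℕ) : ℝ) * (Real.exp a₀ - 1))) * (2 * ((((F.P K).d : ℕ) : ℝ) * ((3 * (F.P K).L : ℕ) : ℝ)) * (2 * (2 * ((((((F.P K).d + 2) * (F.P K).L : ℕ) : ℝ) ^ 2 / 4) * ((C_B + 1) * α)) / (((F.P K).L : ℝ) ^ 2 - ((F.P K).L : ℝ))) * mT + mT * (((1 + 4 * (((F.P K).d + 2 : ℕ) : ℝ)) * Real.exp ((((F.P K).d + 2 : ℕ) : ℝ) * (422 + 1616 * (((F.P K).d + 2 : ℕ) : ℝ)) * (((((((F.P K).d + 2) * (F.P K).L : ℕ) : ℝ) ^ 2 / 4) * ((C_B + 1) * α)) / (((F.P K).L : ℝ) ^ 2 - 1)))) / ((F.P K).L : ℝ)) * ((2 * 67 * ((((F.P K).d + 2) * (F.P K).L : ℕ) : ℝ) / a₀) * (2 * ((((F.P K).d - 1 : ℕ) : ℝ) * ((2 * (F.P K).L : ℕ) : ℝ)) * (2 * ((C_B + 1) * α)) / (((F.P K).L : ℝ) ^ 2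 - 1) + (2 * (2 * ((((((F.P K).d + 2) * (F.P K).L : ℕ) : ℝ) ^ 2 / 4) * ((C_B + 1) * α)) / (((F.P K).L : ℝ) ^ 2 - ((F.P K).L : ℝ))) + (2 * ((C_B + 1) * α))) / (((F.P K).L : ℝ) - 1))) + Cc + 2 * (((1 + 4 * (((F.P K).d + 2 : ℕ) : ℝ)) * Real.exp ((((F.P K).d + 2 : ℕ) : ℝ) * (422 + 1616 * (((F.P K).d + 2 : ℕ) : ℝ)) * (((((((F.P K).d + 2) * (F.P K).L : ℕ) : ℝ) ^ 2 / 4) * ((C_B + 1) * α)) / (((F.P K).L : ℝ) ^ 2 - 1)))) * Cr / (((F.P K).L : ℝ) ^ 2 - ((F.P K).L : ℝ))))) / a₀ ^ 2 +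
          ((((F.P K).d + 2) * (F.P K).L : ℕ) : ℝ) ^ 3 * (((1 + 4 * (((F.P K).d + 2 : ℕ) : ℝ)) * Real.exp ((((F.P K).d + 2 : ℕ) : ℝ) * (422 + 1616 * (((F.P K).d + 2 : ℕ) : ℝ)) * (((((((F.P K).d + 2) * (F.P K).L : ℕ) : ℝ) ^ 2 / 4) * ((C_B + 1) * α)) / (((F.P K).L : ℝ) ^ 2 - 1)))) * (cX + Cr / (((F.P K).L : ℝ) - 1))) ^ 2 + 8 * (67 * (((((F.P K).d + 2) * (F.P K).L : ℕ) : ℝ) * ((((F.P K).d - 1 : ℕ) : ℝ) * ((3 * (F.P K).L : ℕ) : ℝ) * (2 * ((C_B + 1) * α))))) * (((1 + 4 * (((F.P K).d + 2 : ℕ) : ℝ)) * Real.exp ((((F.P K).d + 2 : ℕ) : ℝ) * (422 + 1616 * (((F.P K).d + 2 : ℕ) : ℝ)) * (((((((F.P K).d + 2) * (F.P K).L : ℕ) : ℝ) ^ 2 / 4) * ((C_B + 1) * α)) / (((F.P K).L : ℝ) ^ 2 - 1)))) * (cX + Cr / (((F.P K).L : ℝ) - 1))) / a₀ ^ 2)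 ^ 2 *
        (∑ t ∈ Finset.range (K - J), (if ht : t < K - J then
          (F.L : ℝ) ^ t * ∑ B : PBond (F.P J) 0,
            ‖(fun ℓ' : PBond (F.P (J + (t + 1))) 0 =>
              if ∃ z : Site (F.P (J + (t + 1))) 0,
                (B14.Eq22Determines.blockIter (t + 1) z = (bondShift (F.sitesPerDir_eq (m := F.m) (K := J) (j := 0) (m' := F.m) (K' := J + (t + 1)) (j' := t + 1) (by omega)) B).src ∨ B14.Eq22Determines.blockIter (t + 1) z = (bondShift (F.sitesPerDir_eq (m := F.m) (K := J) (j := 0) (m' := F.m) (K' := J + (t + 1)) (j' := t + 1) (by omega)) B).tgt) ∧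
                ∀ ν, (B10Eq27TorusAxialLog.rel z ℓ'.src ν).natAbs ≤ 2
              then logVec (su2Quat (descendTo F ℰp (J + (t + 1)) K (by omega) (fun ℓ => expPoint (ζ ℓ) * U₀ ℓ : GaugeField (F.P K) 0 (Matrix.specialUnitaryGroup (Fin 2) ℂ)) ℓ' * (descendTo F ℰp (J + (t + 1)) K (by omega) U₀ ℓ')⁻¹)) else 0)‖ ^ 2
        else 0)) / (F.L : ℝ)) +
      3 * ((768 * c ^ 2 * (F.L : ℝ)) *
        (((F.L : ℝ)⁻¹) ^ (K - J) * ∑ ℓ : PBond (F.P K) 0, ‖ζ ℓ‖ ^ 2 +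
          (F.L : ℝ) ^ (K - J) * ∑ p : Plaq (F.P K) 0,
            (1 - reTr ((GaugeField.plaqHol U₀ p)⁻¹ * GaugeField.plaqHol (fun ℓ => expPoint (ζ ℓ) * U₀ ℓ : GaugeField (F.P K) 0 (Matrix.specialUnitaryGroup (Fin 2) ℂ)) p))))))) +
      2 * ((256 * Cst * Mbar ^ 2 * ((2 * (F.P J).d * (2 * 3 + 1) ^ (F.P J).d : ℕ) : ℝ)) * (∑ t ∈ Finset.range (K - J), (if ht : t < K - J then
          (F.L : ℝ) ^ t * ∑ B : PBond (F.P J) 0,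
            ‖(fun ℓ' : PBond (F.P (J + (t + 1))) 0 =>
              if ∃ z : Site (F.P (J + (t + 1))) 0,
                (B14.Eq22Determines.blockIter (t + 1) z = (bondShift (F.sitesPerDir_eq (m := F.m) (K := J) (j := 0) (m' := F.m) (K' := J + (t + 1)) (j' := t + 1) (by omega)) B).src ∨ B14.Eq22Determines.blockIter (t + 1) z = (bondShift (F.sitesPerDir_eq (m := F.m) (K := J) (j := 0) (m' := F.m) (K' := J + (t + 1)) (j' := t + 1) (by omega)) B).tgt) ∧
                ∀ ν, (B10Eq27TorusAxialLog.rel z ℓ'.src ν).natAbs ≤ 2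
              then logVec (su2Quat (descendTo F ℰp (J + (t + 1)) K (by omega) (fun ℓ => expPoint (ζ ℓ) * U₀ ℓ : GaugeField (F.P K) 0 (Matrix.specialUnitaryGroup (Fin 2) ℂ)) ℓ' * (descendTo F ℰp (J + (t + 1)) K (by omega) U₀ ℓ')⁻¹)) else 0)‖ ^ 2
        else 0))) := by
  obtain ⟨hMb0, hMb, hMb16, hMbsq, hMbm⟩ := sizeSide_of_bkg F (J := J) (K := K) U₀ X C_B α hCB hα hBKG h24 hSU r hr0 hr Cr hCr hrp cX hcX hX0 ha16
  exact c1Budget_regRep F hJK Cst hCst U₀ ζ X hXdef Mg hMg hMg4 C_B α hCB hα hBKG h24 hSU hρ0 hρr ha0 ha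
    (fun l : ℕ => ((1 + 4 * (((F.P K).d + 2 : ℕ) : ℝ)) * Real.exp ((((F.P K).d + 2 : ℕ) : ℝ) * (422 + 1616 * (((F.P K).d + 2 : ℕ) : ℝ)) * (((((((F.P K).d + 2) * (F.P K).L : ℕ) : ℝ) ^ 2 / 4) * ((C_B + 1) * α)) / (((F.P K).L : ℝ) ^ 2 - 1)))) * (cX + Cr / (((F.P K).L : ℝ) - 1)) * ((F.P K).L : ℝ) ^ l * ((((F.P K).L : ℝ))⁻¹ ^ (K - J)))
    hMb0 hMb hMb16 r c₀ hwinK hc₀nn hc₀ hr0 hr Cr Cc mT hCr hCc hmT hrp hMT hcc hρα hρδ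
    (((1 + 4 * (((F.P K).d + 2 : ℕ) : ℝ)) * Real.exp ((((F.P K).d + 2 : ℕ) : ℝ) * (422 + 1616 * (((F.P K).d + 2 : ℕ) : ℝ)) * (((((((F.P K).d + 2) * (F.P K).L : ℕ) : ℝ) ^ 2 / 4) * ((C_B + 1) * α)) / (((F.P K).L : ℝ) ^ 2 - 1)))) * (cX + Cr / (((F.P K).L : ℝ) - 1)))
    hMbsq hMbm c hc0 hc4 hζc Mbar hM0 hM1 hM

end Summit.QuantumFields.YangMills.Theorems.FluctuationComparisonRegPrIntLS2BetaCurlBudgetBkgRegRep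

end
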